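import Literature.AlgebraicGeometry.ModuliOfAbelianVarieties.SiegelFamilyHumbertModularEquivalence
import HarnessLib

/-!
# Humbert's lemma: `Sp₄(ℤ)` acts transitively on the primitive singular relations of given invariant `Δ`;
# every primitive relation is `Sp₄(ℤ)`-equivalent to Humbert's normal form `k z₁ + l z₂ = z₃`, `l ∈ {0, 1}`

Layer `Literature/AlgebraicGeometry/ModuliOfAbelianVarieties`, namespace
`Literature.AlgebraicGeometry.ModuliOfAbelianVarieties.SiegelModuli`; lane `lit-hodgefound` (Track 2 foundations library,
Layer A4 "cycle classes / Hodge classes / Néron–Severi / Lefschetz (1,1)"), seat `lit-hodgefound-skel-4`, row **A4-65**, FILE 1.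
Sequel of rows A4-59 (`SiegelFamilyHumbertSurfaces`: `singularRelation q Z = a z₁ + b z₂ + c z₃ + d(z₂² − z₁z₃) + e`,
`humbertInvariant q = Δ = b² − 4ac − 4de`, `humbertLocus q = H_q ⊂ 𝔥₂`, `humbertGram q = N(q)`), A4-59″
(`SiegelFamilyHumbertSymplectic`: the transport `humbertVectorConj M q = q^M := q(ᵗM N(q) M)` of a relation under
`M ∈ Sp₄(ℤ)`, `Δ(q^M) = Δ(q)`, `H_{q^M} = ᵗM · H_q`, `H_Δ(𝔥₂)`) and A4-64 (`SiegelFamilyHumbertModularEmbedding` /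
`…ModularEquivalence`: Humbert's normal form `humbertNormalForm k l = (k, l, −1, 0, 0)`, `quadDisc k l = l² + 4k`, Runge's
modular embedding `π_{k,l} : ℍ × ℍ → 𝔥₂` with `range π_{k,l} = H_{(k,l,−1,0,0)}`, and `exists_shift_of_quadDisc_eq`) — all
consumed BY NAME, nothing restated.

## The theorem and its sources (verbatim)

* B. Runge, *Endomorphism rings of abelian surfaces and projective models of their moduli spaces*, Tohoku Math. J.
  **51** (1999), §4, p. 288: "THEOREM 2. Let `M₁`, `M₂` be Rosati invariant elements in `M₄(ℤ)`. Then there exists an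
  element `σ ∈ Γ₂` such that `σM₁σ⁻¹ = M₂` if and only if `t(M₁) = t(M₂)`, `g.c.d(M₁) = g.c.d(M₂)` and `Δ(M₁) = Δ(M₂)`",
  p. 290: "Therefore we finally obtain a normal form for primitive normalized matrices … `Δ(M) = 4k + l` with `k ∈ ℤ`
  and `l ∈ {0, 1}`. … In classical terminology Humbert proved that up to equivalence any relation may be written as
  `kτ₁ + lτ₂ = τ₃` (see [HM, 2.7])."
* K. Hashimoto, N. Murabayashi, *Shimura curves as intersections of Humbert surfaces and defining equations of
  QM-curves of genus two*, Tohoku Math. J. **47** (1995) — read in the RIMS Kôkyûroku **843** (1993) version held in the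
  corpus, p. 191: "Definition 3.6 (Humbert [7]) For an element `τ = (τ₁ τ₂; τ₂ τ₃)` of `𝔥₂`, it is said that `τ` has a
  singular relation with invariant `Δ` if there exists an element `(a, b, c, d, e) (≠ 0) ∈ ℤ⁵` such that: 1. `a, b, c, d, e`
  are relatively prime 2. `aτ₁ + bτ₂ + cτ₃ + d(τ₂² − τ₁τ₃) + e = 0` 3. `Δ = b² − 4ac − 4de`. … The following result, which
  is stated explicitly in [2] [= van der Geer, *Hilbert modular surfaces*], p. 212, is essentially due to Humbert:
  Proposition 3.7 Each point of `H_Δ` can be represented by `τ ∈ 𝔥₂` satisfying an equation `aτ₁ + bτ₂ + τ₃ = 0` with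
  `b² − 4a = Δ`, `b = 0` or `1`." (Prop. 2.7 of the journal version, as cited by Runge.)
* Ch. Birkenhake, H. Wilhelm, *Humbert surfaces and the Kummer plane*, Trans. AMS **355** (2003), p. 1819: "`H_Δ` is the
  image in `𝒜₂` of the zero locus in `ℌ₂` of any equation of the form (∗) … Note that the equation is not uniquely
  determined because of the action of the symplectic group", p. 1828: "Proposition 4.5. Suppose `Z = (z₁ z₂; z₂ z₃)`
  satisfies equation (8) and `Δ := b² − 4ac − 4de`. There is an `M ∈ Sp₄(ℤ)` such that `M(Z) = (z₁′ z₂′; z₂′ z₃′)` satisfies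
  `−¼Δz₁′ + z₃′ = 0` if `Δ ≡ 0 mod 4`, `¼(1 − Δ)z₁′ + z₂′ + z₃′ = 0` if `Δ ≡ 1 mod 4`." (Printed proof in six steps,
  Steps II and V using "Dirichlet's prime Theorem" and "Since by assumption `Δ` is square-free the matrix `R₄` is
  primitive".)
* J.-W. Guo, Y. Yang, *Class number relations arising from intersections of Shimura curves and Humbert surfaces*
  (arXiv:1903.07225), §2: "A singular relation is called primitive if `gcd(a,b,c,d,e) = 1`. … Humbert proved that under
  the natural projection `ℌ₂ → 𝒜₂`, all primitive singular relations with the same discriminant `n` … defines the same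
  zero locus in `𝒜₂`, which is called the Humbert surface `H_n` of discriminant `n`."

## Contents (definitions with bodies and PROVED theorems; NO named fact, net debt 0)

* §1 `ℤ`-linearity of `q ↦ q^M` (`humbertVectorConj_add/_smul/_neg`), `humbertVectorConj_one`, the `E₁`-component of
  an alternating Gram matrix (`eq_humbertGram_add_smul_typeForm : N = N(q(N)) + n_{x₁y₁} E₁`) and the COCYCLE RULE
  **`humbertVectorConj_mul : q^{MM′} = (q^M)^{M′}`** for `M′ ∈ Sp₄(ℤ)` (a right action of `Sp₄(ℤ)` on `ℤ⁵`).
* §2 `spInv M = −E₁ ᵗM E₁` (`spInv_mul`, `mul_spInv`, `spInv_symplectic`); the equivalence relation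
  **`HumbertEquiv q q′ :⟺ ∃ M ∈ Sp₄(ℤ), q^M = q′`** (`refl/symm/trans`, `humbertInvariant_eq`, `smul`, `neg`, `ne_zero`,
  **`exists_humbertLocus_eq_image : H_{q′} = ᵗM · H_q`**); **`IsPrimitiveRel q`** (`q = m q′ ⟹ m = ±1`, the spelled-out
  predicate of rows A4-61/A4-62/A4-64) with `ne_zero`, `eq_one_or_eq_neg_one_of_dvd`, `exists_not_dvd`, and its
  invariance `of_humbertEquiv` / `HumbertEquiv.isPrimitiveRel_iff`.
* §3 Generators `shearUpper s = (1 S; 0 1)`, `shearLower s = (1 0; S 1)` (`S = (s₁ s₂; s₂ s₃)`), the partial involutions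
  `partialJ₁`, `partialJ₂`, and `E₁`, all in `Sp₄(ℤ)`, with their actions on `(a, b, c, d, e)` computed in closed form
  (`humbertVectorConj_shearUpper/_shearLower/_partialJ₁/_partialJ₂/_typeForm`), e.g. `partialJ₁ : (a,b,c,d,e) ↦ (e,b,d,−c,−a)`
  exchanges the two hyperbolic pairs of `Δ = b² − 4(ac + de)`; `humbertVectorConj_blockDiag_humbertNormalForm` (FILE 4's
  change of generator at vector level) and `humbertEquiv_humbertNormalForm_of_quadDisc_eq`.
* §4 THE REDUCTION (Euclidean descent on `|d|`, replacing B–W's Steps I–V and their appeal to Dirichlet's theorem; no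
  square-freeness): `exists_humbertEquiv_apply_three_ne_zero`, **`exists_humbertEquiv_natAbs_lt`** (for primitive `q`
  with `|d| ≥ 2` an equivalent `q′` with `0 < |d′| < |d|`), `exists_humbertEquiv_apply_three_eq_one`,
  `humbertEquiv_humbertNormalForm_of_apply_three_eq_one` (B–W's Step VI), and **`exists_humbertEquiv_humbertNormalForm`**:
  every primitive `q` is equivalent to some `(k, l, −1, 0, 0)` with `l ∈ {0, 1}`.
* §5 **`IsPrimitiveRel.humbertEquiv_humbertNormalForm`** (`q ∼ (k, l, −1, 0, 0)` for EVERY `(k, l)` with `l² + 4k = Δ(q)`),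
  `…_ediv_emod` (the canonical `(⌊Δ/4⌋, Δ mod 4)`), **`IsPrimitiveRel.humbertEquiv_iff`** (TRANSITIVITY: primitive `q ∼ q′`
  iff `Δ(q) = Δ(q′)` — Runge's Thm. 2 for content `1`), `humbertEquiv_neg` (`q ∼ −q`, although no element of `Sp₄(ℤ)` acts as
  `−1` on `ℤ⁵`), `humbertEquiv_smul` (content `m`), `humbertEquiv_humbertNormalForm_iff` + `eq_of_quadDisc_eq` (uniqueness of
  the normal form), and B–W's two normalisations AS PRINTED for every primitive relation:
  **`IsPrimitiveRel.humbertEquiv_bw_zero : q ∼ (−Δ/4, 0, 1, 0, 0)`** (`Δ ≡ 0 mod 4`),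
  **`IsPrimitiveRel.humbertEquiv_bw_one : q ∼ ((1 − Δ)/4, 1, 1, 0, 0)`** (`Δ ≡ 1 mod 4`).

## Scope / what is NOT formalised here

* The locus-level consequences (Hashimoto–Murabayashi's `N_Δ = {Z ∈ 𝔥₂ : Z has a PRIMITIVE relation of invariant Δ}` is
  the `Sp₄(ℤ)`-saturation of Runge's model `π_{k,l}(ℍ × ℍ)`; `H_Δ(𝔥₂) = ⋃_{f² ∣ Δ} N_{Δ/f²}`) are FILE 2 of this row.
* Runge's Thm. 2 in full (Rosati-invariant MATRICES up to `Γ₂`-conjugacy, with the reduced trace `t(M)`, i.e. the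
  `E₁`-component) is rendered on relation vectors only, where `t` is invisible; the content statement is given in the
  direction "same content and invariant ⟹ equivalent" (`humbertEquiv_smul`); the converse needs the g.c.d. of the entries
  and is left to FILE 2.
* `𝒜₂ = Sp₄(ℤ)\𝔥₂` is not formed; "equivalent" means related by the right action `q ↦ q^M` of integral symplectic matrices
  (`ᵗM E₁ M = E₁`), which act on `𝔥₂` through the tree's `toGD 1 M = ᵗM ∈ Sp₄(ℝ)` (rows A4-16 / A4-59″).

## References

* [Runge1999EndomorphismRingsAbelianSurfaces] B. Runge, Tohoku Math. J. 51 (1999) 283–303, §4 Thm. 2 (p. 288), pp. 289–290.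
* [HashimotoMurabayashi1995] K. Hashimoto, N. Murabayashi, Tohoku Math. J. 47 (1995) 271–296, Def. 3.6 / Prop. 3.7 of the
  RIMS Kôkyûroku 843 (1993) version (p. 191) = Prop. 2.7 of the journal version.
* [BirkenhakeWilhelm2003] Ch. Birkenhake, H. Wilhelm, Trans. AMS 355 (2003) 1819–1841, §1 (∗) (p. 1819), §4 (7) (p. 1827),
  Prop. 4.5 and its proof (pp. 1828–1829).
* [GuoYang2019] J.-W. Guo, Y. Yang, arXiv:1903.07225, §2.
* [vanderGeer1988HilbertModularSurfaces] G. van der Geer, *Hilbert Modular Surfaces*, Springer (1988), Ch. IX §2 (p. 212) —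
  cited through Hashimoto–Murabayashi and Birkenhake–Wilhelm (not held).
* [Lange2023AbelianVarietiesComplex] H. Lange, *Abelian Varieties over the Complex Numbers* (2023), §3.1.2 (3.4), §8.2 (8.5).
-/
noncomputable section

open Matrix Complex Module Function Set

namespace Literature.AlgebraicGeometry.ModuliOfAbelianVarieties

namespace SiegelModuli

open Literature.NumberTheory.Automorphic (siegelUpperHalfSpace)
open Literature.NumberTheory.ModularForms.SiegelUpperHalfSpace
open Literature.Geometry.Kaehler Literature.Geometry.Kaehler.ComplexTorus
open Literature.Analysis.Complex Literature.LinearAlgebra.Alternating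
open Sum

/-! ## §1 Linearity of `q ↦ q^M`, the `E₁`-component of a Gram matrix, and the cocycle rule `q^{MM′} = (q^M)^{M′}` -/

section Linear

/-- `N(q + q′) = N(q) + N(q′)`. [cite: BirkenhakeWilhelm2003, §4 eq. (8)–(9) (p. 1827)] -/
theorem humbertGram_add (q q' : Fin 5 → ℤ) : humbertGram (q + q') = humbertGram q + humbertGram q' := by
  ext i j
  rcases i with i | i <;> rcases j with j | j <;> fin_cases i <;> fin_cases j <;>
    simp [humbertGram, add_comm]

/-- `N(m q) = m N(q)`. [cite: BirkenhakeWilhelm2003, §4 eq. (8)–(9) (p. 1827)] -/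
theorem humbertGram_smul (m : ℤ) (q : Fin 5 → ℤ) : humbertGram (m • q) = m • humbertGram q := by
  ext i j
  simp only [Matrix.smul_apply, smul_eq_mul]
  rcases i with i | i <;> rcases j with j | j <;> fin_cases i <;> fin_cases j <;>
    simp [humbertGram, mul_neg]

/-- `q(m N) = m q(N)`. [cite: BirkenhakeWilhelm2003, §1 (∗) (p. 1819)] -/
theorem humbertVectorOfGram_smul {R : Type*} [CommRing R] (m : R) (N : Matrix (Fin 2 ⊕ Fin 2) (Fin 2 ⊕ Fin 2) R) :
    humbertVectorOfGram (m • N) = m • humbertVectorOfGram N := by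
  funext i
  fin_cases i <;> simp [humbertVectorOfGram, mul_sub]

/-- **`q ↦ q^M` is additive.** [cite: BirkenhakeWilhelm2003, §4 eq. (7) (p. 1827)] -/
theorem humbertVectorConj_add (M : Matrix (Fin 2 ⊕ Fin 2) (Fin 2 ⊕ Fin 2) ℤ) (q q' : Fin 5 → ℤ) :
    humbertVectorConj M (q + q') = humbertVectorConj M q + humbertVectorConj M q' := by
  rw [humbertVectorConj, humbertGram_add, Matrix.mul_add, Matrix.add_mul, humbertVectorOfGram_add]
  rfl

/-- **`q ↦ q^M` is `ℤ`-homogeneous: `(m q)^M = m q^M`.** [cite: BirkenhakeWilhelm2003, §4 eq. (7) (p. 1827)] -/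
theorem humbertVectorConj_smul (M : Matrix (Fin 2 ⊕ Fin 2) (Fin 2 ⊕ Fin 2) ℤ) (m : ℤ) (q : Fin 5 → ℤ) :
    humbertVectorConj M (m • q) = m • humbertVectorConj M q := by
  rw [humbertVectorConj, humbertGram_smul, Matrix.mul_smul, Matrix.smul_mul, humbertVectorOfGram_smul]
  rfl

/-- `(−q)^M = −q^M`. [cite: BirkenhakeWilhelm2003, §4 eq. (7) (p. 1827)] -/
theorem humbertVectorConj_neg (M : Matrix (Fin 2 ⊕ Fin 2) (Fin 2 ⊕ Fin 2) ℤ) (q : Fin 5 → ℤ) :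
    humbertVectorConj M (-q) = -humbertVectorConj M q := by
  rw [← neg_one_smul ℤ q, humbertVectorConj_smul, neg_one_smul]

/-- `q^1 = q`. [cite: BirkenhakeWilhelm2003, §4 eq. (7) (p. 1827)] -/
@[simp] theorem humbertVectorConj_one (q : Fin 5 → ℤ) : humbertVectorConj 1 q = q := by
  rw [humbertVectorConj, transpose_one, Matrix.one_mul, Matrix.mul_one, humbertVectorOfGram_humbertGram]

/-- **An alternating integer Gram matrix is determined by its relation vector up to the polarisation:
`N = N(q(N)) + n_{x₁y₁} · E₁`** (`q(N)` forgets exactly the `E₁ = (0 1₂; −1₂ 0)`-component, cf. B–W (8)–(9):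
"`φ_L = φ_{L₀} a₁ + f`", the multiple of the principal polarisation is invisible in the singular relation).
[cite: BirkenhakeWilhelm2003, §4 eq. (8)–(9) (p. 1827)] -/
theorem eq_humbertGram_add_smul_typeForm {N : Matrix (Fin 2 ⊕ Fin 2) (Fin 2 ⊕ Fin 2) ℤ} (hN : Nᵀ = -N) :
    N = humbertGram (humbertVectorOfGram N) + N (inl 0) (inr 0) • typeForm (fun _ : Fin 2 ↦ 1) := by
  have hanti : ∀ a b, N b a = -N a b := fun a b ↦ by
    have h := congrFun (congrFun hN a) b
    rwa [transpose_apply, Matrix.neg_apply] at h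
  have hd : ∀ a, N a a = 0 := fun a ↦ by have := hanti a a; omega
  ext i j
  simp only [Matrix.add_apply, Matrix.smul_apply, smul_eq_mul]
  rcases i with i | i <;> rcases j with j | j <;> fin_cases i <;> fin_cases j <;>
    simp [humbertGram, humbertVectorOfGram, typeForm, hd, hanti (inl 0) (inl 1), hanti (inl 0) (inr 0),
      hanti (inl 0) (inr 1), hanti (inl 1) (inr 0), hanti (inl 1) (inr 1), hanti (inr 0) (inr 1)]
  ring

/-- `q(t E₁) = 0`: the principal polarisation has the zero relation (row A4-59 `humbertVector_prinForm`).
[cite: BirkenhakeWilhelm2003, §4 Prop. 4.7 ("`H_0 = 𝒜₂`", p. 1830)] -/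
theorem humbertVectorOfGram_smul_typeForm (t : ℤ) :
    humbertVectorOfGram (t • typeForm (fun _ : Fin 2 ↦ 1)) = 0 := by
  funext i
  fin_cases i <;> simp [humbertVectorOfGram, typeForm]

/-- **The cocycle rule `q^{MM′} = (q^M)^{M′}` for `M′ ∈ Sp₄(ℤ)`** (the `E₁`-component created by `M` is killed by
`q`, and `ᵗM′ E₁ M′ = E₁`): `q ↦ q^M` is a right action of `Sp₄(ℤ)` on `ℤ⁵`. [cite: BirkenhakeWilhelm2003, §4 eq. (7) (p. 1827)] -/
theorem humbertVectorConj_mul (M M' : Matrix (Fin 2 ⊕ Fin 2) (Fin 2 ⊕ Fin 2) ℤ)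
    (hM' : M'ᵀ * typeForm (fun _ : Fin 2 ↦ 1) * M' = typeForm fun _ : Fin 2 ↦ 1) (q : Fin 5 → ℤ) :
    humbertVectorConj (M * M') q = humbertVectorConj M' (humbertVectorConj M q) := by
  set X := Mᵀ * humbertGram q * M with hX
  have hXt : Xᵀ = -X := by
    rw [hX, transpose_mul, transpose_mul, transpose_transpose, humbertGram_transpose, Matrix.neg_mul,
      Matrix.mul_neg, Matrix.mul_assoc]
  have hdec := eq_humbertGram_add_smul_typeForm hXt
  have h1 : humbertVectorConj (M * M') q = humbertVectorOfGram (M'ᵀ * X * M') := by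
    rw [humbertVectorConj, transpose_mul, hX]
    simp only [Matrix.mul_assoc]
  have h2 : humbertVectorConj M q = humbertVectorOfGram X := rfl
  rw [h1, h2]
  conv_lhs => rw [hdec]
  rw [Matrix.mul_add, Matrix.add_mul, Matrix.mul_smul, Matrix.smul_mul, hM', humbertVectorOfGram_add,
    humbertVectorOfGram_smul_typeForm, add_zero]
  rfl

end Linear

/-! ## §2 The symplectic inverse and the equivalence relation on relations -/

section Equiv

/-- `E₁² = −1`. [cite: Lange2023AbelianVarietiesComplex, §3.1.2 (3.4)] -/
theorem typeForm_one_mul_self : typeForm (fun _ : Fin 2 ↦ 1) * typeForm (fun _ : Fin 2 ↦ 1) = -1 := by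
  decide

/-- The product of two symplectic integer matrices is symplectic. [cite: Lange2023AbelianVarietiesComplex, §8.2 (8.5)] -/
theorem symplectic_mul {M M' : Matrix (Fin 2 ⊕ Fin 2) (Fin 2 ⊕ Fin 2) ℤ}
    (hM : Mᵀ * typeForm (fun _ : Fin 2 ↦ 1) * M = typeForm fun _ : Fin 2 ↦ 1)
    (hM' : M'ᵀ * typeForm (fun _ : Fin 2 ↦ 1) * M' = typeForm fun _ : Fin 2 ↦ 1) :
    (M * M')ᵀ * typeForm (fun _ : Fin 2 ↦ 1) * (M * M') = typeForm fun _ : Fin 2 ↦ 1 := by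
  calc (M * M')ᵀ * typeForm (fun _ : Fin 2 ↦ 1) * (M * M')
      = M'ᵀ * (Mᵀ * typeForm (fun _ : Fin 2 ↦ 1) * M) * M' := by
        rw [transpose_mul]; simp only [Matrix.mul_assoc]
    _ = typeForm fun _ : Fin 2 ↦ 1 := by rw [hM, hM']

/-- **The symplectic inverse `M⁻¹ = −E₁ ᵗM E₁`** of `M ∈ Sp₄(ℤ)` (`E₁⁻¹ = −E₁`). [cite: Lange2023AbelianVarietiesComplex, §8.2 (8.5)] -/
def spInv (M : Matrix (Fin 2 ⊕ Fin 2) (Fin 2 ⊕ Fin 2) ℤ) : Matrix (Fin 2 ⊕ Fin 2) (Fin 2 ⊕ Fin 2) ℤ :=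
  -(typeForm (fun _ : Fin 2 ↦ 1) * Mᵀ * typeForm (fun _ : Fin 2 ↦ 1))

/-- `M⁻¹ M = 1`. [cite: Lange2023AbelianVarietiesComplex, §8.2 (8.5)] -/
theorem spInv_mul {M : Matrix (Fin 2 ⊕ Fin 2) (Fin 2 ⊕ Fin 2) ℤ}
    (hM : Mᵀ * typeForm (fun _ : Fin 2 ↦ 1) * M = typeForm fun _ : Fin 2 ↦ 1) : spInv M * M = 1 := by
  have hM' : Mᵀ * (typeForm (fun _ : Fin 2 ↦ 1) * M) = typeForm fun _ : Fin 2 ↦ 1 := by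
    simpa only [Matrix.mul_assoc] using hM
  rw [spInv, Matrix.neg_mul]
  simp only [Matrix.mul_assoc]
  rw [hM', typeForm_one_mul_self, neg_neg]

/-- `M M⁻¹ = 1`. [cite: Lange2023AbelianVarietiesComplex, §8.2 (8.5)] -/
theorem mul_spInv {M : Matrix (Fin 2 ⊕ Fin 2) (Fin 2 ⊕ Fin 2) ℤ}
    (hM : Mᵀ * typeForm (fun _ : Fin 2 ↦ 1) * M = typeForm fun _ : Fin 2 ↦ 1) : M * spInv M = 1 :=
  mul_eq_one_comm.2 (spInv_mul hM)

/-- `M⁻¹ ∈ Sp₄(ℤ)`. [cite: Lange2023AbelianVarietiesComplex, §8.2 (8.5)] -/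
theorem spInv_symplectic {M : Matrix (Fin 2 ⊕ Fin 2) (Fin 2 ⊕ Fin 2) ℤ}
    (hM : Mᵀ * typeForm (fun _ : Fin 2 ↦ 1) * M = typeForm fun _ : Fin 2 ↦ 1) :
    (spInv M)ᵀ * typeForm (fun _ : Fin 2 ↦ 1) * spInv M = typeForm fun _ : Fin 2 ↦ 1 := by
  have h1 := mul_spInv hM
  calc (spInv M)ᵀ * typeForm (fun _ : Fin 2 ↦ 1) * spInv M
      = (spInv M)ᵀ * (Mᵀ * typeForm (fun _ : Fin 2 ↦ 1) * M) * spInv M := by rw [hM]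
    _ = (M * spInv M)ᵀ * typeForm (fun _ : Fin 2 ↦ 1) * (M * spInv M) := by
        rw [transpose_mul]; simp only [Matrix.mul_assoc]
    _ = typeForm fun _ : Fin 2 ↦ 1 := by rw [h1, transpose_one, Matrix.one_mul, Matrix.mul_one]

/-- `(q^M)^{M⁻¹} = q`. [cite: BirkenhakeWilhelm2003, §4 eq. (7) (p. 1827)] -/
theorem humbertVectorConj_spInv_humbertVectorConj {M : Matrix (Fin 2 ⊕ Fin 2) (Fin 2 ⊕ Fin 2) ℤ}
    (hM : Mᵀ * typeForm (fun _ : Fin 2 ↦ 1) * M = typeForm fun _ : Fin 2 ↦ 1) (q : Fin 5 → ℤ) :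
    humbertVectorConj (spInv M) (humbertVectorConj M q) = q := by
  rw [← humbertVectorConj_mul M (spInv M) (spInv_symplectic hM), mul_spInv hM, humbertVectorConj_one]

/-- `(q^{M⁻¹})^M = q`. [cite: BirkenhakeWilhelm2003, §4 eq. (7) (p. 1827)] -/
theorem humbertVectorConj_humbertVectorConj_spInv {M : Matrix (Fin 2 ⊕ Fin 2) (Fin 2 ⊕ Fin 2) ℤ}
    (hM : Mᵀ * typeForm (fun _ : Fin 2 ↦ 1) * M = typeForm fun _ : Fin 2 ↦ 1) (q : Fin 5 → ℤ) :
    humbertVectorConj M (humbertVectorConj (spInv M) q) = q := by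
  rw [← humbertVectorConj_mul (spInv M) M hM, spInv_mul hM, humbertVectorConj_one]

/-- **`Sp₄(ℤ)`-equivalence of integer singular relations: `q ∼ q′` iff `q′ = q^M` for some `M ∈ Sp₄(ℤ)`**
("the equation is not uniquely determined because of the action of the symplectic group", B–W p. 1819;
"Humbert proved that up to equivalence any relation may be written as `kτ₁ + lτ₂ = τ₃`", Runge p. 290).
[cite: BirkenhakeWilhelm2003, §1 (∗) (p. 1819)] [cite: Runge1999EndomorphismRingsAbelianSurfaces, §4 p. 290] -/
def HumbertEquiv (q q' : Fin 5 → ℤ) : Prop :=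
  ∃ M : Matrix (Fin 2 ⊕ Fin 2) (Fin 2 ⊕ Fin 2) ℤ,
    Mᵀ * typeForm (fun _ : Fin 2 ↦ 1) * M = typeForm (fun _ : Fin 2 ↦ 1) ∧ humbertVectorConj M q = q'

namespace HumbertEquiv

variable {q q' q'' : Fin 5 → ℤ}

/-- Reflexivity. [cite: BirkenhakeWilhelm2003, §1 (∗) (p. 1819)] -/
protected theorem refl (q : Fin 5 → ℤ) : HumbertEquiv q q :=
  ⟨1, by rw [transpose_one, Matrix.one_mul, Matrix.mul_one], humbertVectorConj_one q⟩

/-- Transitivity (`q^{MM′} = (q^M)^{M′}`). [cite: BirkenhakeWilhelm2003, §4 eq. (7) (p. 1827)] -/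
protected theorem trans (h : HumbertEquiv q q') (h' : HumbertEquiv q' q'') : HumbertEquiv q q'' := by
  obtain ⟨M, hM, rfl⟩ := h
  obtain ⟨M', hM', rfl⟩ := h'
  exact ⟨M * M', symplectic_mul hM hM', humbertVectorConj_mul M M' hM' q⟩

/-- Symmetry (`(q^M)^{M⁻¹} = q`). [cite: BirkenhakeWilhelm2003, §4 eq. (7) (p. 1827)] -/
protected theorem symm (h : HumbertEquiv q q') : HumbertEquiv q' q := by
  obtain ⟨M, hM, rfl⟩ := h
  exact ⟨spInv M, spInv_symplectic hM, humbertVectorConj_spInv_humbertVectorConj hM q⟩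

/-- `q ∼ q′ ⟺ q′ ∼ q`. [cite: BirkenhakeWilhelm2003, §4 eq. (7) (p. 1827)] -/
protected theorem comm : HumbertEquiv q q' ↔ HumbertEquiv q' q := ⟨HumbertEquiv.symm, HumbertEquiv.symm⟩

/-- **Equivalent relations have the same invariant `Δ`** (row A4-59″ `humbertInvariant_humbertVectorConj`).
[cite: BirkenhakeWilhelm2003, §1 (∗) (p. 1819)] -/
theorem humbertInvariant_eq (h : HumbertEquiv q q') : humbertInvariant q' = humbertInvariant q := by
  obtain ⟨M, hM, rfl⟩ := h
  exact humbertInvariant_humbertVectorConj hM q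

/-- `q ∼ q′ ⟹ m q ∼ m q′`. [cite: BirkenhakeWilhelm2003, §4 eq. (7) (p. 1827)] -/
theorem smul (h : HumbertEquiv q q') (m : ℤ) : HumbertEquiv (m • q) (m • q') := by
  obtain ⟨M, hM, rfl⟩ := h
  exact ⟨M, hM, humbertVectorConj_smul M m q⟩

/-- `q ∼ q′ ⟹ −q ∼ −q′`. [cite: BirkenhakeWilhelm2003, §4 eq. (7) (p. 1827)] -/
theorem neg (h : HumbertEquiv q q') : HumbertEquiv (-q) (-q') := by
  simpa only [neg_one_smul] using h.smul (-1)

/-- Equivalent relations vanish together (row A4-59″ `humbertVectorConj_ne_zero`). [cite: BirkenhakeWilhelm2003, §4 eq. (7) (p. 1827)] -/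
theorem ne_zero (h : HumbertEquiv q q') (hq : q ≠ 0) : q' ≠ 0 := by
  obtain ⟨M, hM, rfl⟩ := h
  exact humbertVectorConj_ne_zero hM hq

/-- **Equivalent relations have `Sp₄(ℤ)`-translate Humbert loci: `H_{q′} = ᵗM · H_q`** (row A4-59″ (7),
`mem_humbertLocus_humbertVectorConj_iff`; `M` acts on `𝔥₂` through `toGD 1 M ∈ Sp₄(ℝ)`, row A4-16).
[cite: BirkenhakeWilhelm2003, §1 (∗) (p. 1819)] [cite: BirkenhakeWilhelm2003, §4 eq. (7) (p. 1827)] -/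
theorem exists_humbertLocus_eq_image (h : HumbertEquiv q q') :
    ∃ (M : Matrix (Fin 2 ⊕ Fin 2) (Fin 2 ⊕ Fin 2) ℤ)
      (hM : Mᵀ * typeForm (fun _ : Fin 2 ↦ 1) * M = typeForm (fun _ : Fin 2 ↦ 1)),
      humbertVectorConj M q = q' ∧
      humbertLocus (fun i ↦ (q' i : ℂ)) =
        (fun Z ↦ (⟨toGD (fun _ : Fin 2 ↦ 1) M, toGD_mem principalType_pos hM⟩ : Matrix.symplecticGroup (Fin 2) ℝ) • Z) ''
          humbertLocus (fun i ↦ (q i : ℂ)) := by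
  obtain ⟨M, hM, rfl⟩ := h
  refine ⟨M, hM, rfl, ?_⟩
  set P : Matrix.symplecticGroup (Fin 2) ℝ := ⟨toGD (fun _ : Fin 2 ↦ 1) M, toGD_mem principalType_pos hM⟩
  ext Z
  rw [mem_humbertLocus_humbertVectorConj_iff hM q Z, Set.mem_image]
  constructor
  · intro hZ
    exact ⟨P⁻¹ • Z, hZ, smul_inv_smul P Z⟩
  · rintro ⟨W, hW, rfl⟩
    change P⁻¹ • P • W ∈ _
    rwa [inv_smul_smul]

end HumbertEquiv

/-- **Primitive integer vectors** (`q = m q′ ⟹ m = ±1`; "`a, b, c, d, e` are relatively prime",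
Hashimoto–Murabayashi Def. 3.6; "a singular relation is called primitive if `gcd(a,b,c,d,e) = 1`") — the predicate
used verbatim by rows A4-61/A4-62 (Kani's primitive classes) and FILE 1 `humbertNormalForm_primitive`.
[cite: HashimotoMurabayashi1995, Def. 3.6 (RIMS Kôkyûroku 843 version, p. 191)] [cite: GuoYang2019, §2 (singular relations)] -/
def IsPrimitiveRel (q : Fin 5 → ℤ) : Prop :=
  ∀ (m : ℤ) (q' : Fin 5 → ℤ), q = m • q' → m = 1 ∨ m = -1

/-- Unfolding of `IsPrimitiveRel`. [cite: HashimotoMurabayashi1995, Def. 3.6] -/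
theorem isPrimitiveRel_iff (q : Fin 5 → ℤ) :
    IsPrimitiveRel q ↔ ∀ (m : ℤ) (q' : Fin 5 → ℤ), q = m • q' → m = 1 ∨ m = -1 :=
  Iff.rfl

namespace IsPrimitiveRel

variable {q q' : Fin 5 → ℤ}

/-- A primitive vector is non-zero. [cite: HashimotoMurabayashi1995, Def. 3.6] -/
theorem ne_zero (hq : IsPrimitiveRel q) : q ≠ 0 := by
  rintro rfl
  rcases hq 0 0 (by rw [zero_smul]) with h | h <;> simp at h

/-- **A common divisor of the entries of a primitive vector is `±1`.** [cite: HashimotoMurabayashi1995, Def. 3.6] -/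
theorem eq_one_or_eq_neg_one_of_dvd (hq : IsPrimitiveRel q) {n : ℤ} (h : ∀ i, n ∣ q i) : n = 1 ∨ n = -1 := by
  choose f hf using h
  exact hq n f (funext fun i ↦ by rw [Pi.smul_apply, smul_eq_mul]; exact hf i)

/-- A divisor of all entries with `|n| ≠ 1` does not exist: `2 ≤ |n| ⟹ ∃ i, n ∤ q i`.
[cite: HashimotoMurabayashi1995, Def. 3.6] -/
theorem exists_not_dvd (hq : IsPrimitiveRel q) {n : ℤ} (hn : 2 ≤ n.natAbs) : ∃ i, ¬ n ∣ q i := by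
  by_contra h
  push Not at h
  rcases hq.eq_one_or_eq_neg_one_of_dvd h with rfl | rfl <;> simp at hn

/-- **Primitivity is an invariant of `Sp₄(ℤ)`-equivalence** (`q ↦ q^M` is `ℤ`-linear with inverse `q ↦ q^{M⁻¹}`).
[cite: BirkenhakeWilhelm2003, §4 eq. (7) (p. 1827)] -/
theorem of_humbertEquiv (hq : IsPrimitiveRel q) (h : HumbertEquiv q q') : IsPrimitiveRel q' := by
  intro m q'' hq''
  obtain ⟨M, hM, hMq⟩ := h.symm
  refine hq m (humbertVectorConj M q'') ?_
  rw [← hMq, hq'', humbertVectorConj_smul]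

/-- `−q` is primitive with `q`. [cite: HashimotoMurabayashi1995, Def. 3.6] -/
theorem neg (hq : IsPrimitiveRel q) : IsPrimitiveRel (-q) := by
  intro m q'' h
  have := hq (-m) q'' (by rw [neg_smul, ← h, neg_neg])
  omega

end IsPrimitiveRel

/-- `HumbertEquiv` preserves primitivity in both directions. [cite: BirkenhakeWilhelm2003, §4 eq. (7) (p. 1827)] -/
theorem HumbertEquiv.isPrimitiveRel_iff {q q' : Fin 5 → ℤ} (h : HumbertEquiv q q') :
    IsPrimitiveRel q ↔ IsPrimitiveRel q' :=
  ⟨fun hq ↦ hq.of_humbertEquiv h, fun hq' ↦ hq'.of_humbertEquiv h.symm⟩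

/-- FILE 1's normal form is primitive, in the present vocabulary. [cite: Runge1999EndomorphismRingsAbelianSurfaces, §4 p. 290] -/
theorem isPrimitiveRel_humbertNormalForm (k l : ℤ) : IsPrimitiveRel (humbertNormalForm k l) :=
  humbertNormalForm_primitive k l

end Equiv

/-! ## §3 Generators of `Sp₄(ℤ)` and their action on relation vectors -/

section Generators

/-- **The unipotent `(1₂ S; 0 1₂)`, `S = (s₁ s₂; s₂ s₃)` symmetric integral** (B–W's `M₁`, Step II of the proof of
Prop. 4.5, is of this shape). [cite: BirkenhakeWilhelm2003, §4 proof of Prop. 4.5, Step II (p. 1828)] -/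
def shearUpper (s₁ s₂ s₃ : ℤ) : Matrix (Fin 2 ⊕ Fin 2) (Fin 2 ⊕ Fin 2) ℤ :=
  Matrix.fromBlocks 1 !![s₁, s₂; s₂, s₃] 0 1

/-- **The unipotent `(1₂ 0; S 1₂)`, `S = (s₁ s₂; s₂ s₃)` symmetric integral** (acting on `𝔥₂` through `toGD 1`,
i.e. by `ᵗM`, as the translation `Z ↦ Z + S`; B–W's `M₅`, Step VI). [cite: BirkenhakeWilhelm2003, §4 proof of Prop. 4.5, Step VI (p. 1829)] -/
def shearLower (s₁ s₂ s₃ : ℤ) : Matrix (Fin 2 ⊕ Fin 2) (Fin 2 ⊕ Fin 2) ℤ :=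
  Matrix.fromBlocks 1 0 !![s₁, s₂; s₂, s₃] 1

/-- **The partial symplectic involution on the first pair: `x₁ ↦ y₁ ↦ −x₁`, `x₂, y₂` fixed** (B–W's `M₀` with
`(α, β; c/g₀, e/g₀) = 1₂`, Step I). [cite: BirkenhakeWilhelm2003, §4 proof of Prop. 4.5, Step I (p. 1828)] -/
def partialJ₁ : Matrix (Fin 2 ⊕ Fin 2) (Fin 2 ⊕ Fin 2) ℤ :=
  Matrix.fromBlocks !![0, 0; 0, 1] !![-1, 0; 0, 0] !![1, 0; 0, 0] !![0, 0; 0, 1]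

/-- **The partial symplectic involution on the second pair: `x₂ ↦ y₂ ↦ −x₂`, `x₁, y₁` fixed.**
[cite: BirkenhakeWilhelm2003, §4 proof of Prop. 4.5, Step I (p. 1828)] -/
def partialJ₂ : Matrix (Fin 2 ⊕ Fin 2) (Fin 2 ⊕ Fin 2) ℤ :=
  Matrix.fromBlocks !![1, 0; 0, 0] !![0, 0; 0, -1] !![0, 0; 0, 1] !![1, 0; 0, 0]

/-- `(1 S; 0 1) ∈ Sp₄(ℤ)`. [cite: BirkenhakeWilhelm2003, §4 proof of Prop. 4.5 (p. 1828)] -/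
theorem shearUpper_symplectic (s₁ s₂ s₃ : ℤ) :
    (shearUpper s₁ s₂ s₃)ᵀ * typeForm (fun _ : Fin 2 ↦ 1) * shearUpper s₁ s₂ s₃ = typeForm fun _ : Fin 2 ↦ 1 := by
  ext i j
  rcases i with i | i <;> rcases j with j | j <;> fin_cases i <;> fin_cases j <;>
    simp [shearUpper, typeForm, Matrix.mul_apply, Fintype.sum_sum_type, Fin.sum_univ_two]

/-- `(1 0; S 1) ∈ Sp₄(ℤ)`. [cite: BirkenhakeWilhelm2003, §4 proof of Prop. 4.5 (p. 1829)] -/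
theorem shearLower_symplectic (s₁ s₂ s₃ : ℤ) :
    (shearLower s₁ s₂ s₃)ᵀ * typeForm (fun _ : Fin 2 ↦ 1) * shearLower s₁ s₂ s₃ = typeForm fun _ : Fin 2 ↦ 1 := by
  ext i j
  rcases i with i | i <;> rcases j with j | j <;> fin_cases i <;> fin_cases j <;>
    simp [shearLower, typeForm, Matrix.mul_apply, Fintype.sum_sum_type, Fin.sum_univ_two]

/-- `partialJ₁ ∈ Sp₄(ℤ)`. [cite: BirkenhakeWilhelm2003, §4 proof of Prop. 4.5 (p. 1828)] -/
theorem partialJ₁_symplectic :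
    partialJ₁ᵀ * typeForm (fun _ : Fin 2 ↦ 1) * partialJ₁ = typeForm fun _ : Fin 2 ↦ 1 := by
  decide

/-- `partialJ₂ ∈ Sp₄(ℤ)`. [cite: BirkenhakeWilhelm2003, §4 proof of Prop. 4.5 (p. 1828)] -/
theorem partialJ₂_symplectic :
    partialJ₂ᵀ * typeForm (fun _ : Fin 2 ↦ 1) * partialJ₂ = typeForm fun _ : Fin 2 ↦ 1 := by
  decide

/-- `E₁ ∈ Sp₄(ℤ)` (`ᵗE₁ E₁ E₁ = E₁`). [cite: Lange2023AbelianVarietiesComplex, §3.1.2 (3.4)] -/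
theorem typeForm_symplectic :
    (typeForm (fun _ : Fin 2 ↦ 1))ᵀ * typeForm (fun _ : Fin 2 ↦ 1) * typeForm (fun _ : Fin 2 ↦ 1) =
      typeForm fun _ : Fin 2 ↦ 1 := by
  decide

/-- **Action of `(1 S; 0 1)`: `(a, b, c, d, e) ↦ (a − e s₁, b − 2e s₂, c − e s₃, d + a s₃ − b s₂ + c s₁ + e(s₂² − s₁s₃), e)`**
— `e` is fixed, `a, c` move by multiples of `e`, `b` by even multiples of `e`, and for `e = 0` the coordinate `d` moves by
an arbitrary `ℤ`-combination of `a, b, c`. [cite: BirkenhakeWilhelm2003, §4 eq. (7) and proof of Prop. 4.5 (pp. 1827–1829)] -/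
theorem humbertVectorConj_shearUpper (s₁ s₂ s₃ : ℤ) (q : Fin 5 → ℤ) :
    humbertVectorConj (shearUpper s₁ s₂ s₃) q =
      ![q 0 - q 4 * s₁, q 1 - 2 * q 4 * s₂, q 2 - q 4 * s₃,
        q 3 + q 0 * s₃ - q 1 * s₂ + q 2 * s₁ + q 4 * (s₂ ^ 2 - s₁ * s₃), q 4] := by
  funext i
  fin_cases i <;>
    simp [humbertVectorConj, humbertVectorOfGram, humbertGram, shearUpper, Matrix.mul_apply,
      Fintype.sum_sum_type, Fin.sum_univ_two] <;> ring

/-- **Action of `(1 0; S 1)`: `(a, b, c, d, e) ↦ (a + d s₃, b − 2d s₂, c + d s₁, d, e − a s₁ − b s₂ − c s₃ + d(s₂² − s₁s₃))`**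
— `d` is fixed, `a, c` move by multiples of `d` and `b` by even multiples of `d` (B–W Step VI: "`b′ = 0` if `b₅` is
even and `b′ = 1` if `b₅` is odd"). [cite: BirkenhakeWilhelm2003, §4 eq. (7) and proof of Prop. 4.5, Step VI (p. 1829)] -/
theorem humbertVectorConj_shearLower (s₁ s₂ s₃ : ℤ) (q : Fin 5 → ℤ) :
    humbertVectorConj (shearLower s₁ s₂ s₃) q =
      ![q 0 + q 3 * s₃, q 1 - 2 * q 3 * s₂, q 2 + q 3 * s₁, q 3,
        q 4 - q 0 * s₁ - q 1 * s₂ - q 2 * s₃ + q 3 * (s₂ ^ 2 - s₁ * s₃)] := by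
  funext i
  fin_cases i <;>
    simp [humbertVectorConj, humbertVectorOfGram, humbertGram, shearLower, Matrix.mul_apply,
      Fintype.sum_sum_type, Fin.sum_univ_two] <;> ring

/-- **Action of `partialJ₁`: `(a, b, c, d, e) ↦ (e, b, d, −c, −a)`** — the two hyperbolic pairs `(a, c)`, `(d, e)` of
`Δ = b² − 4ac − 4de` are exchanged. [cite: BirkenhakeWilhelm2003, §4 eq. (7) and proof of Prop. 4.5, Step I (p. 1828)] -/
theorem humbertVectorConj_partialJ₁ (q : Fin 5 → ℤ) :
    humbertVectorConj partialJ₁ q = ![q 4, q 1, q 3, -q 2, -q 0] := by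
  funext i
  fin_cases i <;>
    simp [humbertVectorConj, humbertVectorOfGram, humbertGram, partialJ₁, Matrix.mul_apply,
      Fintype.sum_sum_type, Fin.sum_univ_two]

/-- **Action of `partialJ₂`: `(a, b, c, d, e) ↦ (d, b, e, −a, −c)`.** [cite: BirkenhakeWilhelm2003, §4 eq. (7) and proof of Prop. 4.5, Step I (p. 1828)] -/
theorem humbertVectorConj_partialJ₂ (q : Fin 5 → ℤ) :
    humbertVectorConj partialJ₂ q = ![q 3, q 1, q 4, -q 0, -q 2] := by
  funext i
  fin_cases i <;>
    simp [humbertVectorConj, humbertVectorOfGram, humbertGram, partialJ₂, Matrix.mul_apply,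
      Fintype.sum_sum_type, Fin.sum_univ_two]

/-- **Action of `E₁` (the involution `Z ↦ −Z⁻¹` of `𝔥₂` up to the tree's transposition convention):
`(a, b, c, d, e) ↦ (−c, b, −a, −e, −d)`.** [cite: BirkenhakeWilhelm2003, §4 eq. (7) (p. 1827)] -/
theorem humbertVectorConj_typeForm (q : Fin 5 → ℤ) :
    humbertVectorConj (typeForm fun _ : Fin 2 ↦ 1) q = ![-q 2, q 1, -q 0, -q 4, -q 3] := by
  funext i
  fin_cases i <;>
    simp [humbertVectorConj, humbertVectorOfGram, humbertGram, typeForm, Matrix.mul_apply,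
      Fintype.sum_sum_type, Fin.sum_univ_two]

/-- **Action of `diag(V, ᵗW)`, `W = V⁻¹`, on Humbert's normal forms: the change of generator `ω ↦ ω + u` of the
order** — `(k, l, −1, 0, 0)^{diag(U, ᵗU⁻¹)} = (k − lu − u², l + 2u, −1, 0, 0)`, `U = (1 u; 0 1)` (FILE 4
`modularEmbedding_shift_eq_smul` at the level of relation vectors). [cite: Runge1999EndomorphismRingsAbelianSurfaces, §4 p. 290] -/
theorem humbertVectorConj_blockDiag_humbertNormalForm (k l u : ℤ) :
    humbertVectorConj (blockDiag !![1, u; 0, 1] !![1, -u; 0, 1]) (humbertNormalForm k l) =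
      humbertNormalForm (k - l * u - u ^ 2) (l + 2 * u) := by
  funext i
  fin_cases i <;>
    simp [humbertVectorConj, humbertVectorOfGram, humbertGram, blockDiag, humbertNormalForm, Matrix.mul_apply,
      Fintype.sum_sum_type, Fin.sum_univ_two] <;> ring

variable {q : Fin 5 → ℤ}

/-- `q ∼ q^{(1 S; 0 1)}`. [cite: BirkenhakeWilhelm2003, §4 proof of Prop. 4.5 (p. 1828)] -/
theorem humbertEquiv_shearUpper (s₁ s₂ s₃ : ℤ) (q : Fin 5 → ℤ) :
    HumbertEquiv q ![q 0 - q 4 * s₁, q 1 - 2 * q 4 * s₂, q 2 - q 4 * s₃,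
        q 3 + q 0 * s₃ - q 1 * s₂ + q 2 * s₁ + q 4 * (s₂ ^ 2 - s₁ * s₃), q 4] :=
  ⟨shearUpper s₁ s₂ s₃, shearUpper_symplectic s₁ s₂ s₃, humbertVectorConj_shearUpper s₁ s₂ s₃ q⟩

/-- `q ∼ q^{(1 0; S 1)}`. [cite: BirkenhakeWilhelm2003, §4 proof of Prop. 4.5 (p. 1829)] -/
theorem humbertEquiv_shearLower (s₁ s₂ s₃ : ℤ) (q : Fin 5 → ℤ) :
    HumbertEquiv q ![q 0 + q 3 * s₃, q 1 - 2 * q 3 * s₂, q 2 + q 3 * s₁, q 3,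
        q 4 - q 0 * s₁ - q 1 * s₂ - q 2 * s₃ + q 3 * (s₂ ^ 2 - s₁ * s₃)] :=
  ⟨shearLower s₁ s₂ s₃, shearLower_symplectic s₁ s₂ s₃, humbertVectorConj_shearLower s₁ s₂ s₃ q⟩

/-- `q ∼ (e, b, d, −c, −a)`. [cite: BirkenhakeWilhelm2003, §4 proof of Prop. 4.5 (p. 1828)] -/
theorem humbertEquiv_partialJ₁ (q : Fin 5 → ℤ) : HumbertEquiv q ![q 4, q 1, q 3, -q 2, -q 0] :=
  ⟨partialJ₁, partialJ₁_symplectic, humbertVectorConj_partialJ₁ q⟩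

/-- `q ∼ (d, b, e, −a, −c)`. [cite: BirkenhakeWilhelm2003, §4 proof of Prop. 4.5 (p. 1828)] -/
theorem humbertEquiv_partialJ₂ (q : Fin 5 → ℤ) : HumbertEquiv q ![q 3, q 1, q 4, -q 0, -q 2] :=
  ⟨partialJ₂, partialJ₂_symplectic, humbertVectorConj_partialJ₂ q⟩

/-- `q ∼ (−c, b, −a, −e, −d)`. [cite: BirkenhakeWilhelm2003, §4 eq. (7) (p. 1827)] -/
theorem humbertEquiv_typeForm (q : Fin 5 → ℤ) : HumbertEquiv q ![-q 2, q 1, -q 0, -q 4, -q 3] :=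
  ⟨typeForm fun _ : Fin 2 ↦ 1, typeForm_symplectic, humbertVectorConj_typeForm q⟩

/-- **`q ∼ (−a, b, −c, −d, −e)`** (`partialJ₁` twice = `−1` on the first pair). [cite: BirkenhakeWilhelm2003, §4 eq. (7) (p. 1827)] -/
theorem humbertEquiv_neg_four (q : Fin 5 → ℤ) : HumbertEquiv q ![-q 0, q 1, -q 2, -q 3, -q 4] := by
  have h := (humbertEquiv_partialJ₁ q).trans (humbertEquiv_partialJ₁ _)
  simpa using h

/-- **Two normal forms of the same discriminant are equivalent** (change of generator; FILE 4 at vector level).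
[cite: Runge1999EndomorphismRingsAbelianSurfaces, §4 p. 290] -/
theorem humbertEquiv_humbertNormalForm_shift (k l u : ℤ) :
    HumbertEquiv (humbertNormalForm k l) (humbertNormalForm (k - l * u - u ^ 2) (l + 2 * u)) := by
  refine ⟨blockDiag !![1, u; 0, 1] !![1, -u; 0, 1], transpose_blockDiag_mul_typeForm_mul ?_,
    humbertVectorConj_blockDiag_humbertNormalForm k l u⟩
  ext i j
  fin_cases i <;> fin_cases j <;> simp [Matrix.mul_apply, Fin.sum_univ_two]

/-- **Normal forms with equal discriminants are equivalent.** [cite: Runge1999EndomorphismRingsAbelianSurfaces, §4 p. 290] -/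
theorem humbertEquiv_humbertNormalForm_of_quadDisc_eq {k l k' l' : ℤ} (h : quadDisc k' l' = quadDisc k l) :
    HumbertEquiv (humbertNormalForm k l) (humbertNormalForm k' l') := by
  obtain ⟨u, rfl, rfl⟩ := exists_shift_of_quadDisc_eq h
  exact humbertEquiv_humbertNormalForm_shift k l u

end Generators

/-! ## §4 Humbert's reduction: descent on `|d|` to `d = 1`, then to the normal form -/

section Descent

variable {q : Fin 5 → ℤ}

/-- Transport of an equivalence along an equality of targets. [folklore] -/
private theorem humbertEquiv_congr {q p p' : Fin 5 → ℤ} (h : HumbertEquiv q p) (hp : p = p') : HumbertEquiv q p' :=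
  hp ▸ h

/-- Size bookkeeping for a remainder: `d ∤ x ⟹ x mod d ≠ 0` and `|x mod d| < |d|`. [folklore] -/
private theorem emod_aux {x d : ℤ} (hd : d ≠ 0) (hx : ¬ d ∣ x) : x % d ≠ 0 ∧ (x % d).natAbs < d.natAbs := by
  refine ⟨fun h ↦ hx (Int.dvd_of_emod_eq_zero h), ?_⟩
  rw [← Int.natAbs_abs d]
  exact Int.natAbs_lt_natAbs_of_nonneg_of_lt (Int.emod_nonneg x hd) (Int.emod_lt_abs x hd)

/-- **Entry point of the reduction: every non-zero relation is equivalent to one with `d ≠ 0`** (if `d = e = 0`,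
the unipotent `(1 S; 0 1)` with `S = (c −b; −b a)` produces `d′ = a² + b² + c² > 0`; if `d = 0 ≠ e`, apply `E₁`).
[cite: BirkenhakeWilhelm2003, §4 proof of Prop. 4.5 (pp. 1828–1829)] -/
theorem exists_humbertEquiv_apply_three_ne_zero (hq : q ≠ 0) : ∃ q', HumbertEquiv q q' ∧ q' 3 ≠ 0 := by
  by_cases h3 : q 3 ≠ 0
  · exact ⟨q, HumbertEquiv.refl q, h3⟩
  by_cases h4 : q 4 ≠ 0
  · exact ⟨_, humbertEquiv_typeForm q, by simpa using h4⟩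
  push Not at h3 h4
  refine ⟨_, humbertEquiv_shearUpper (q 2) (-(q 1)) (q 0) q, ?_⟩
  intro h0
  simp [h3, h4] at h0
  have hsq : q 0 ^ 2 + q 1 ^ 2 + q 2 ^ 2 = 0 := by linear_combination h0
  have e0 : q 0 = 0 := (pow_eq_zero_iff two_ne_zero).1 (by nlinarith [sq_nonneg (q 0), sq_nonneg (q 1), sq_nonneg (q 2)])
  have e1 : q 1 = 0 := (pow_eq_zero_iff two_ne_zero).1 (by nlinarith [sq_nonneg (q 0), sq_nonneg (q 1), sq_nonneg (q 2)])
  have e2 : q 2 = 0 := (pow_eq_zero_iff two_ne_zero).1 (by nlinarith [sq_nonneg (q 0), sq_nonneg (q 1), sq_nonneg (q 2)])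
  exact hq (funext fun i ↦ by fin_cases i <;> simp [e0, e1, e2, h3, h4])

/-- **The descent step.** For a PRIMITIVE relation with `|d| ≥ 2` there is an equivalent relation with `0 < |d′| < |d|`:
reduce `a, c` modulo `d` by `(1 0; S 1)`; if a remainder is non-zero, move it to the `d`-slot by a partial involution;
otherwise `q ∼ (0, b, 0, d, e₁) ∼ (e₁, b, d, 0, 0)` and `(1 S; 0 1)` makes `d′ = b mod d` (if `d ∤ b`) or `d′ = e₁ mod d`
(if `d ∣ b`, when `d ∤ e₁` by primitivity) — the Euclidean algorithm replacing B–W's Steps I–IV (which invoke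
Dirichlet's theorem on primes in arithmetic progressions) and needing no square-freeness of `Δ`.
[cite: BirkenhakeWilhelm2003, §4 proof of Prop. 4.5, Steps I–IV (pp. 1828–1829)] [cite: Runge1999EndomorphismRingsAbelianSurfaces, §4 proof of Thm. 2 (pp. 288–290)] -/
theorem exists_humbertEquiv_natAbs_lt (hq : IsPrimitiveRel q) (hd : q 3 ≠ 0) (h2 : 2 ≤ (q 3).natAbs) :
    ∃ q', HumbertEquiv q q' ∧ q' 3 ≠ 0 ∧ (q' 3).natAbs < (q 3).natAbs := by
  -- moving a small non-zero entry from slot `0`, `2` or `3` to slot `3`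
  have key : ∀ p : Fin 5 → ℤ, HumbertEquiv q p → ∀ r : ℤ, (p 0 = r ∨ p 2 = r ∨ p 3 = r) → r ≠ 0 →
      r.natAbs < (q 3).natAbs → ∃ q', HumbertEquiv q q' ∧ q' 3 ≠ 0 ∧ (q' 3).natAbs < (q 3).natAbs := by
    rintro p hp r (h | h | h) hr hlt
    · exact ⟨_, hp.trans (humbertEquiv_partialJ₂ p), by simpa [h] using hr, by simpa [h] using hlt⟩
    · exact ⟨_, hp.trans (humbertEquiv_partialJ₁ p), by simpa [h] using hr, by simpa [h] using hlt⟩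
    · exact ⟨p, hp, h ▸ hr, h ▸ hlt⟩
  -- Step 1: reduce `a` and `c` modulo `d`
  obtain ⟨e₁, h₁⟩ : ∃ e₁ : ℤ, HumbertEquiv q ![q 0 % q 3, q 1, q 2 % q 3, q 3, e₁] := by
    refine ⟨q 4 - q 0 * -(q 2 / q 3) - q 1 * 0 - q 2 * -(q 0 / q 3) + q 3 * (0 ^ 2 - -(q 2 / q 3) * -(q 0 / q 3)),
      humbertEquiv_congr (humbertEquiv_shearLower (-(q 2 / q 3)) 0 (-(q 0 / q 3)) q) ?_⟩
    funext i
    fin_cases i <;> simp [Int.emod_def, sub_eq_add_neg]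
  by_cases hc : q 3 ∣ q 2
  swap
  · obtain ⟨hr, hlt⟩ := emod_aux hd hc
    exact key _ h₁ (q 2 % q 3) (Or.inr (Or.inl (by simp))) hr hlt
  by_cases ha : q 3 ∣ q 0
  swap
  · obtain ⟨hr, hlt⟩ := emod_aux hd ha
    exact key _ h₁ (q 0 % q 3) (Or.inl (by simp)) hr hlt
  rw [Int.emod_eq_zero_of_dvd ha, Int.emod_eq_zero_of_dvd hc] at h₁
  -- Step 2: `(0, b, 0, d, e₁) ∼ (e₁, b, d, 0, 0)`
  have h₂ : HumbertEquiv q ![e₁, q 1, q 3, 0, 0] := by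
    have h := h₁.trans (humbertEquiv_partialJ₁ _)
    simpa using h
  by_cases hb : q 3 ∣ q 1
  · -- `d ∣ b`: then `d ∤ e₁` by primitivity, and `d′ = e₁ mod d`
    have hprim₂ := hq.of_humbertEquiv h₂
    have he : ¬ q 3 ∣ e₁ := by
      intro he
      rcases hprim₂.eq_one_or_eq_neg_one_of_dvd (n := q 3) (fun i ↦ by fin_cases i <;> simp [he, hb]) with h | h <;>
        simp [h] at h2
    obtain ⟨hr, hlt⟩ := emod_aux hd he
    refine key _ (h₂.trans (humbertEquiv_shearUpper (-(e₁ / q 3)) 0 1 _)) (e₁ % q 3) (Or.inr (Or.inr ?_)) hr hlt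
    simp [Int.emod_def, sub_eq_add_neg]
  · -- `d ∤ b`: `d′ = b mod d`
    obtain ⟨hr, hlt⟩ := emod_aux hd hb
    refine key _ (h₂.trans (humbertEquiv_shearUpper (-(q 1 / q 3)) (-1) 0 _)) (q 1 % q 3) (Or.inr (Or.inr ?_)) hr hlt
    simp [Int.emod_def, sub_eq_add_neg]

/-- **Every primitive relation is equivalent to one with `d = 1`** (strong induction on `|d|` by the descent step;
`d = −1` is turned into `d = 1` by `−1` on the first symplectic pair). [cite: BirkenhakeWilhelm2003, §4 proof of Prop. 4.5, Steps I–V (pp. 1828–1829)] -/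
theorem exists_humbertEquiv_apply_three_eq_one (hq : IsPrimitiveRel q) : ∃ q', HumbertEquiv q q' ∧ q' 3 = 1 := by
  suffices H : ∀ (n : ℕ) (p : Fin 5 → ℤ), IsPrimitiveRel p → p 3 ≠ 0 → (p 3).natAbs = n →
      ∃ q', HumbertEquiv p q' ∧ q' 3 = 1 by
    obtain ⟨q₀, h₀, hd₀⟩ := exists_humbertEquiv_apply_three_ne_zero hq.ne_zero
    obtain ⟨q', h', h1⟩ := H _ q₀ (hq.of_humbertEquiv h₀) hd₀ rfl
    exact ⟨q', h₀.trans h', h1⟩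
  intro n
  refine Nat.strong_induction_on n fun n ih ↦ ?_
  intro p hp hp3 hn
  by_cases h2 : 2 ≤ (p 3).natAbs
  · obtain ⟨p', hpp', hp'3, hlt⟩ := exists_humbertEquiv_natAbs_lt hp hp3 h2
    obtain ⟨q', h', h1⟩ := ih _ (hn ▸ hlt) p' (hp.of_humbertEquiv hpp') hp'3 rfl
    exact ⟨q', hpp'.trans h', h1⟩
  · have h1 : (p 3).natAbs = 1 := by have := Int.natAbs_pos.2 hp3; omega
    rcases Int.natAbs_eq_iff.1 h1 with h | h
    · exact ⟨p, HumbertEquiv.refl p, by simpa using h⟩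
    · exact ⟨_, humbertEquiv_neg_four p, by simp [h]⟩

/-- **From `d = 1` to Humbert's normal form**: for `p = (a, b, c, 1, e)` the translation `(1 0; S 1)` with
`S = (−c, ⌊b/2⌋; ⌊b/2⌋, −a)` gives `(0, l, 0, 1, e₁)`, `l = b mod 2 ∈ {0, 1}`, and the partial involution (taken with the
sign that makes the `z₃`-coefficient `−1`) gives `(k, l, −1, 0, 0)` with `k = b⌊b/2⌋ − ⌊b/2⌋² − ac − e` (B–W Step VI:
"`τ := b₅/2` if `b₅` is even, `(b₅ − 1)/2` if `b₅` is odd … `b′ = 0` if `b₅` is even and `b′ = 1` if `b₅` is odd").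
[cite: BirkenhakeWilhelm2003, §4 proof of Prop. 4.5, Step VI (p. 1829)] [cite: Runge1999EndomorphismRingsAbelianSurfaces, §4 p. 290] -/
theorem humbertEquiv_humbertNormalForm_of_apply_three_eq_one {p : Fin 5 → ℤ} (hp3 : p 3 = 1) :
    HumbertEquiv p (humbertNormalForm (p 1 * (p 1 / 2) - (p 1 / 2) ^ 2 - p 0 * p 2 - p 4) (p 1 % 2)) := by
  have h := ((humbertEquiv_shearLower (-(p 2)) (p 1 / 2) (-(p 0)) p).trans (humbertEquiv_partialJ₁ _)).trans
    (humbertEquiv_neg_four _)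
  convert h using 2
  funext i
  fin_cases i <;> simp [humbertNormalForm, hp3, Int.emod_def]
  ring

/-- **HUMBERT'S LEMMA (normal form).** Every PRIMITIVE integer singular relation `q = (a, b, c, d, e)` is
`Sp₄(ℤ)`-equivalent to a normal form `(k, l, −1, 0, 0)`, i.e. `k z₁ + l z₂ = z₃`, with `l ∈ {0, 1}` (and then
`l² + 4k = Δ(q)`: `HumbertEquiv.humbertInvariant_eq`, `humbertInvariant_humbertNormalForm`) — "Humbert proved that up
to equivalence any relation may be written as `kτ₁ + lτ₂ = τ₃`" (Runge, citing Hashimoto–Murabayashi Prop. 2.7: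
"Each point of `H_Δ` can be represented by `τ ∈ 𝔥₂` satisfying an equation `aτ₁ + bτ₂ + τ₃ = 0` with `b² − 4a = Δ`,
`b = 0` or `1`", after van der Geer IX (2.?) p. 212 and Humbert); B–W Prop. 4.5 (printed proof for square-free `Δ`).
[cite: Runge1999EndomorphismRingsAbelianSurfaces, §4 p. 290 and Thm. 2 (p. 288)] [cite: HashimotoMurabayashi1995, Prop. 2.7 (= Prop. 3.7, p. 191, of the RIMS Kôkyûroku 843 (1993) version)] [cite: BirkenhakeWilhelm2003, §4 Prop. 4.5 (p. 1828)] [cite: vanderGeer1988HilbertModularSurfaces, Ch. IX §2 (p. 212)] -/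
theorem exists_humbertEquiv_humbertNormalForm (hq : IsPrimitiveRel q) :
    ∃ k l : ℤ, (l = 0 ∨ l = 1) ∧ HumbertEquiv q (humbertNormalForm k l) := by
  obtain ⟨p, hp, hp3⟩ := exists_humbertEquiv_apply_three_eq_one hq
  exact ⟨_, p 1 % 2, Int.emod_two_eq_zero_or_one _, hp.trans (humbertEquiv_humbertNormalForm_of_apply_three_eq_one hp3)⟩

end Descent

/-! ## §5 Transitivity of `Sp₄(ℤ)` on primitive relations of given invariant; the normal form of invariant `Δ` -/

section Transitive

variable {q q' : Fin 5 → ℤ}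

/-- **A primitive relation is equivalent to EVERY normal form of its invariant** (`l² + 4k = Δ(q)`, `l` arbitrary).
[cite: Runge1999EndomorphismRingsAbelianSurfaces, §4 Thm. 2 (p. 288) and p. 290] -/
theorem IsPrimitiveRel.humbertEquiv_humbertNormalForm (hq : IsPrimitiveRel q) {k l : ℤ}
    (h : quadDisc k l = humbertInvariant q) : HumbertEquiv q (humbertNormalForm k l) := by
  obtain ⟨k₀, l₀, -, h₀⟩ := exists_humbertEquiv_humbertNormalForm hq
  have hΔ : quadDisc k l = quadDisc k₀ l₀ := by
    rw [h, ← h₀.humbertInvariant_eq, humbertInvariant_humbertNormalForm]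
  exact h₀.trans (humbertEquiv_humbertNormalForm_of_quadDisc_eq hΔ)

/-- `Δ = (Δ mod 4)² + 4⌊Δ/4⌋` for `Δ ≡ 0, 1 mod 4` — the normal form `(⌊Δ/4⌋, Δ mod 4, −1, 0, 0)` has invariant `Δ`.
[cite: Runge1999EndomorphismRingsAbelianSurfaces, §4 p. 290 ("`Δ(M) = 4k + l` with `l ∈ {0, 1}`")] -/
theorem quadDisc_ediv_emod {Δ : ℤ} (h : Δ % 4 = 0 ∨ Δ % 4 = 1) : quadDisc (Δ / 4) (Δ % 4) = Δ := by
  rw [quadDisc]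
  rcases h with h | h <;> rw [h] <;> omega

/-- **The CANONICAL normal form of a primitive relation: `q ∼ (⌊Δ/4⌋, Δ mod 4, −1, 0, 0)`, `Δ = Δ(q)`** ("`Δ(M) = 4k + l`
with `k ∈ ℤ` and `l ∈ {0, 1}`"). [cite: Runge1999EndomorphismRingsAbelianSurfaces, §4 p. 290] [cite: HashimotoMurabayashi1995, Prop. 2.7] -/
theorem IsPrimitiveRel.humbertEquiv_humbertNormalForm_ediv_emod (hq : IsPrimitiveRel q) :
    HumbertEquiv q (humbertNormalForm (humbertInvariant q / 4) (humbertInvariant q % 4)) :=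
  hq.humbertEquiv_humbertNormalForm (quadDisc_ediv_emod (humbertInvariant_emod_four q))

/-- **HUMBERT'S LEMMA (transitivity): two PRIMITIVE singular relations are `Sp₄(ℤ)`-equivalent iff they have the
same invariant `Δ`** — Runge's Thm. 2 for primitive normalized Rosati-invariant matrices ("there exists `σ ∈ Γ₂` such
that `σM₁σ⁻¹ = M₂` if and only if `t(M₁) = t(M₂)`, `g.c.d(M₁) = g.c.d(M₂)` and `Δ(M₁) = Δ(M₂)`"; the reduced trace `t` is
the `E₁`-component, invisible on relation vectors); Guo–Yang: "Humbert proved that under the natural projection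
`𝔥₂ → 𝒜₂`, all primitive singular relations with the same discriminant … define the same zero locus in `𝒜₂`".
[cite: Runge1999EndomorphismRingsAbelianSurfaces, §4 Thm. 2 (p. 288)] [cite: GuoYang2019, §2] [cite: BirkenhakeWilhelm2003, §1 (∗) (p. 1819)] -/
theorem IsPrimitiveRel.humbertEquiv_iff (hq : IsPrimitiveRel q) (hq' : IsPrimitiveRel q') :
    HumbertEquiv q q' ↔ humbertInvariant q = humbertInvariant q' := by
  refine ⟨fun h ↦ h.humbertInvariant_eq.symm, fun h ↦ ?_⟩
  obtain ⟨k, l, -, hk⟩ := exists_humbertEquiv_humbertNormalForm hq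
  have h' : quadDisc k l = humbertInvariant q' := by
    rw [← h, ← hk.humbertInvariant_eq, humbertInvariant_humbertNormalForm]
  exact hk.trans (hq'.humbertEquiv_humbertNormalForm h').symm

/-- Transitivity, one direction as a term. [cite: Runge1999EndomorphismRingsAbelianSurfaces, §4 Thm. 2 (p. 288)] -/
theorem IsPrimitiveRel.humbertEquiv_of_humbertInvariant_eq (hq : IsPrimitiveRel q) (hq' : IsPrimitiveRel q')
    (h : humbertInvariant q = humbertInvariant q') : HumbertEquiv q q' :=
  (hq.humbertEquiv_iff hq').2 h

/-- **`q ∼ −q` for primitive `q`** (the relations `q = 0` and `−q = 0` coincide; note that NO single element of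
`Sp₄(ℤ)` acts as `−1` on all relation vectors — `−1₄` acts trivially). [cite: Runge1999EndomorphismRingsAbelianSurfaces, §4 Thm. 2 (p. 288)] -/
theorem IsPrimitiveRel.humbertEquiv_neg (hq : IsPrimitiveRel q) : HumbertEquiv q (-q) :=
  hq.humbertEquiv_of_humbertInvariant_eq hq.neg (by rw [← neg_one_smul ℤ q, humbertInvariant_smul]; ring)

/-- **Multiples: `m q ∼ ±m q′` for primitive `q, q′` of the same invariant** (Runge's Thm. 2 with content
`g.c.d(M₁) = g.c.d(M₂) = |m|`). [cite: Runge1999EndomorphismRingsAbelianSurfaces, §4 Thm. 2 (p. 288)] -/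
theorem IsPrimitiveRel.humbertEquiv_smul (hq : IsPrimitiveRel q) (hq' : IsPrimitiveRel q')
    (h : humbertInvariant q = humbertInvariant q') (m : ℤ) :
    HumbertEquiv (m • q) (m • q') ∧ HumbertEquiv (m • q) (-m • q') := by
  refine ⟨(hq.humbertEquiv_of_humbertInvariant_eq hq' h).smul m, ?_⟩
  rw [neg_smul, ← smul_neg]
  exact ((hq.humbertEquiv_of_humbertInvariant_eq hq' h).trans hq'.humbertEquiv_neg).smul m

/-- **Uniqueness of the normal form: `(k, l, −1, 0, 0) ∼ (k′, l′, −1, 0, 0) ⟺ l² + 4k = l′² + 4k′`**, and for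
`l, l′ ∈ {0, 1}` iff `(k, l) = (k′, l′)` ("a uniquely determined normalized one", B–W before Prop. 4.5).
[cite: BirkenhakeWilhelm2003, §4 Prop. 4.5 (p. 1828)] [cite: Runge1999EndomorphismRingsAbelianSurfaces, §4 p. 290] -/
theorem humbertEquiv_humbertNormalForm_iff (k l k' l' : ℤ) :
    HumbertEquiv (humbertNormalForm k l) (humbertNormalForm k' l') ↔ quadDisc k l = quadDisc k' l' := by
  refine ⟨fun h ↦ ?_, fun h ↦ humbertEquiv_humbertNormalForm_of_quadDisc_eq h.symm⟩
  rw [← humbertInvariant_humbertNormalForm, ← humbertInvariant_humbertNormalForm, h.humbertInvariant_eq]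

/-- For `l, l′ ∈ {0, 1}`: equal discriminants force `(k, l) = (k′, l′)`. [cite: Runge1999EndomorphismRingsAbelianSurfaces, §4 p. 290] -/
theorem eq_of_quadDisc_eq {k l k' l' : ℤ} (hl : l = 0 ∨ l = 1) (hl' : l' = 0 ∨ l' = 1)
    (h : quadDisc k l = quadDisc k' l') : k = k' ∧ l = l' := by
  simp only [quadDisc] at h
  rcases hl with rfl | rfl <;> rcases hl' with rfl | rfl <;> omega

/-- **Birkenhake–Wilhelm's normalisation, `Δ ≡ 0 mod 4`: `q ∼ (−Δ/4, 0, 1, 0, 0)`**, i.e. "`−¼Δ z₁′ + z₃′ = 0`", for every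
PRIMITIVE `q` of invariant `Δ` (no square-freeness needed). [cite: BirkenhakeWilhelm2003, §4 Prop. 4.5 (p. 1828)] -/
theorem IsPrimitiveRel.humbertEquiv_bw_zero (hq : IsPrimitiveRel q) (h0 : humbertInvariant q % 4 = 0) :
    HumbertEquiv q ![-(humbertInvariant q / 4), 0, 1, 0, 0] := by
  have hform : (![-(humbertInvariant q / 4), 0, 1, 0, 0] : Fin 5 → ℤ) = -humbertNormalForm (humbertInvariant q / 4) 0 := by
    funext i; fin_cases i <;> simp [humbertNormalForm]
  rw [hform]
  refine (hq.humbertEquiv_humbertNormalForm ?_).trans (isPrimitiveRel_humbertNormalForm _ _).humbertEquiv_neg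
  have := quadDisc_ediv_emod (humbertInvariant_emod_four q)
  rwa [h0] at this

/-- **Birkenhake–Wilhelm's normalisation, `Δ ≡ 1 mod 4`: `q ∼ ((1 − Δ)/4, 1, 1, 0, 0)`**, i.e.
"`¼(1 − Δ)z₁′ + z₂′ + z₃′ = 0`", for every PRIMITIVE `q` of invariant `Δ`. [cite: BirkenhakeWilhelm2003, §4 Prop. 4.5 (p. 1828)] -/
theorem IsPrimitiveRel.humbertEquiv_bw_one (hq : IsPrimitiveRel q) (h1 : humbertInvariant q % 4 = 1) :
    HumbertEquiv q ![(1 - humbertInvariant q) / 4, 1, 1, 0, 0] := by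
  have h14 : (1 - humbertInvariant q) / 4 = -(humbertInvariant q / 4) := by omega
  have hform : (![(1 - humbertInvariant q) / 4, 1, 1, 0, 0] : Fin 5 → ℤ) =
      -humbertNormalForm (humbertInvariant q / 4) (-1) := by
    funext i; fin_cases i <;> simp [humbertNormalForm, h14]
  rw [hform]
  refine (hq.humbertEquiv_humbertNormalForm ?_).trans (isPrimitiveRel_humbertNormalForm _ _).humbertEquiv_neg
  have := quadDisc_ediv_emod (humbertInvariant_emod_four q)
  rw [h1] at this
  rw [quadDisc] at this ⊢
  linear_combination this

end Transitive

end SiegelModuli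

end Literature.AlgebraicGeometry.ModuliOfAbelianVarieties

end
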